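import Summits.BirchSwinnertonDyer.BirchSwinnertonDyer.Theorems.TeichmullerTwistDescentOrdinaryLowValuationOfSaturation
import Summits.BirchSwinnertonDyer.BirchSwinnertonDyer.Theorems.TeichmullerTwistDescentKFiveOfNamedInputs
import HarnessLib

/-!
# Route `TeichmullerTwistDescent`: the Kummer corner's Manin unit FROM the five named inputs of K AND the Manin unit of the optimal
# curve of the `p*`-TWISTED (starred) class — the transferred prefix of the GE11 argument and its one non-transferring step, as a theorem

Cell `pub/bsd-wall` (D-0145 line route-BirchSwinnertonDyer-TeichmullerTwistDescent, OPEN rev 8), seat `bsd-line-ttd-p1` (prover 1/2,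
g29).  THEOREMS ONLY; `--supports stmt-BirchSwinnertonDyer-24306`.  BSD is not proved by this file; no item is closed by it; CORNER
(stmt-BirchSwinnertonDyer-23883) / WILD (24306) / TAME (24307) are NOT proved — they are reduced, F″-free, to ONE explicit hypothesis.

WHAT.  GE11 `OrdinaryLowValuationOptimalManinUnitGeEleven` (p ≥ 11) follows from K by the glue `ordinaryLowValuationOfSaturation_proof`:
the star involution without loss (`padicValInt_c_add_le_of_twist_datum_of_saturation`, any odd `p`) bounds `ord_p c(D)` by `ord_p c(D')`
for any conductor-level datum `D'` of the minimal model `V` of `W ⊗ χ_{p*}`, and a `p`-GOOD `D'` comes from the `X₀`-optimal curve `W₀`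
of the twisted class, for which `p ∤ c(D₀)` is Edixhoven 1991 Thm. 3 (types IV*, III*, II*; typed `7 < p`).  With «K₅»
(`KFive.twistedPeriodLatticeSaturation_five_of_named_inputs`: K's text for `5 ≤ p` from the five named inputs) every step runs at `p ≥ 5`
EXCEPT Edixhoven's theorem.  So:

* `not_dvd_c_of_named_inputs_of_starredClass` — for `W` minimal, `5 ≤ p`, additive, (G)-ordinary, `ord_pΔ_min ≤ 4`, `E[p]` irreducible,
  `D` lattice-optimal at conductor level: GRANTED the five named inputs AND «every `X₀`-optimal curve isogenous to a minimal model of the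
  `p*`-twist of `W` has `p ∤ c`», `p ∤ c(D)`;
* `kummerCorner_of_named_inputs_of_starredClass` — the same on CORNER's own binders (`(p, ord_pΔ) ∈ {(5, 3), (7, 2)}`; the `ℚ_p`-rational
  `p`-torsion point is not used): CORNER ⟸ five prints ∧ the STARRED partner's Manin unit.

THE NON-TRANSFERRING STEP, typed (seat memo KLINE-CORNER-ttdp1g29.md): the hypothesis `hStar` below.  At `p = 7` the partner class is
Kodaira IV* at 7 (`e = 3 < p − 1`: inside Edixhoven's method, outside his printed range `p > 7`); at `p = 5` it is III* at 5 (`e = 4 = p − 1`: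
outside the method too — the starred Kummer corner).  No held source proves either; this file does NOT claim them.
-/

set_option autoImplicit false
-- single-conjunct summit: `Summit.BirchSwinnertonDyer.BirchSwinnertonDyer.…` repeats the name by design
set_option linter.dupNamespace false

noncomputable section

open scoped Classical NumberField

open WeierstrassCurve IsDedekindDomain Rat.HeightOneSpectrum
  Literature.NumberTheory.EllipticCurves Literature.NumberTheory.EllipticCurves.ModularForms
  Literature.NumberTheory.EllipticCurves.Rank1Residual Literature.NumberTheory.DiophantineGeometry
  Summit.BirchSwinnertonDyer.Rank1Residual Summit.BirchSwinnertonDyer.Rank1Residual.Additive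
  Summit.BirchSwinnertonDyer.BirchSwinnertonDyer.Theses.TeichmullerTwistDescent
  Summit.BirchSwinnertonDyer.BirchSwinnertonDyer.Theorems.TeichmullerTwistDescentStarInvolution
open Literature.NumberTheory.Automorphic (edixhoven1992_serreWeight_le_weight_of_newform)

namespace Summit.BirchSwinnertonDyer.BirchSwinnertonDyer.Theorems.TeichmullerTwistDescent

namespace KFive

/-- Level bookkeeping: a `p`-good datum at level `N` is a `p`-good datum at any equal level. [folklore] -/
private theorem exists_datum_not_dvd_of_level_eq {W : WeierstrassCurve ℚ} {N M : ℕ} [NeZero N]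
    [NeZero M] (h : N = M) {p : ℕ} (D : ModularParametrizationData W N) (hc : ¬ (p : ℤ) ∣ D.c) :
    ∃ D' : ModularParametrizationData W M, ¬ (p : ℤ) ∣ D'.c := by
  subst h
  exact ⟨D, hc⟩

/-- **`p ∤ c(D)` for the unstarred (G)-ordinary optimal curve at ANY `p ≥ 5`, from the five named inputs of K and the Manin unit of the
optimal curve of the `p*`-twisted class.**  `W/ℚ` globally minimal, `5 ≤ p`, additive and (G)-ordinary at `p` with `ord_pΔ_min ≤ 4`, `E[p]`
irreducible, `D` a lattice-optimal `X₀(N)`-datum; GRANTED modularity, the CDT tame type (central), the signed BDJ/AS weight statement, Kraus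
Prop. 1, Edixhoven 1992 Thm. 4.5 — which give K₅ at `(W, p, D, χ_{p*})` — AND `hStar`: every `X₀`-optimal curve `W₀` isogenous to a globally
minimal model `V = C • W ⊗ χ_{p*}` has `p ∤ c(D₀)`.  Then `p ∤ c(D)`: transport `D₀` to a `p`-good conductor-level datum `D'` of `V`
(prime-to-`p` cyclic isogeny, `E[p]` irreducible) and apply the loss-free star involution `ord_p c(D) + ord_p u(C) ≤ ord_p c(D')` with
`ord_p u = 0`.  At `p ≥ 11` `hStar` is Edixhoven 1991 Thm. 3 (the tree's GE11 glue); at `p ∈ {5, 7}` it is NOT in print.  BSD is not proved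
by this. [cite: EdixhovenManin1991, §4 (typescript L602–640)] [cite: Stevens1989, Lemma (5.4) p. 97] -/
theorem not_dvd_c_of_named_inputs_of_starredClass (hnf : exists_isNewformOf)
    (hT : fullLevelHomology_isIsotypic_tamePrincipalSeries_of_central)
    (hWt : fullLevelHomology_twist_isModular_of_eigenMap_signed)
    (hKr : Kraus1997.propOne_inertiaShape_of_ordinary) (hEd : edixhoven1992_serreWeight_le_weight_of_newform)
    (W : WeierstrassCurve ℚ) [W.IsElliptic] [W.IsGloballyMinimal] (p : ℕ) [Fact p.Prime] [NeZero (W.conductorNorm ℤ)]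
    (D : ModularParametrizationData W (W.conductorNorm ℤ)) (hp5 : 5 ≤ p)
    (hadd : Addv W p) (hirr : Irr W p) (hG : TypeGOrd W p) (hV4 : padicValInt p W.minimalDiscriminantInt ≤ 4)
    (hopt : ∀ z ∈ D.L.lattice, ∃ w ∈ periodLattice D.f, z = D.c * w)
    (hStar : ∀ (V : WeierstrassCurve ℚ) [V.IsElliptic] [V.IsGloballyMinimal] (C : VariableChange ℚ),
      C • W.quadraticTwist ((-1 : ℚ) ^ (p / 2) * p) = V →
      ∀ (W₀ : WeierstrassCurve ℚ) [W₀.IsElliptic] [W₀.IsGloballyMinimal] [NeZero (W₀.conductorNorm ℤ)]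
        (D₀ : ModularParametrizationData W₀ (W₀.conductorNorm ℤ)),
        IsIsogenous V W₀ → (∀ z ∈ D₀.L.lattice, ∃ w ∈ periodLattice D₀.f, z = D₀.c * w) → ¬ (p : ℤ) ∣ D₀.c) :
    ¬ (p : ℤ) ∣ D.c := by
  have hpP : p.Prime := Fact.out
  have hp2 : p ≠ 2 := by omega
  have hj : 0 ≤ padicValRat p W.j := padicValRat_j_nonneg_of_typeGOrd W p hG
  have hW6 : padicValInt p W.minimalDiscriminantInt < 6 := by omega
  have hpN : p ^ 2 ∣ W.conductorNorm ℤ := sq_dvd_conductorNorm_of_not_good_of_not_mult hadd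
  -- the minimal model `V` of the `p*`-twist: additive, `ord_p u = 0`, same conductor
  obtain ⟨V, hVe, hVm, C, hC⟩ := exists_minimal_twist_pStar p W
  haveI := hVe
  haveI := hVm
  haveI : NeZero (V.conductorNorm ℤ) := ⟨(conductorNorm_pos_holds V).ne'⟩
  obtain ⟨hV, hjV, -⟩ := addv_of_twist_pStar p hp2 W V hj hW6 C hC
  obtain ⟨hu, -⟩ := padicValRat_u_eq_zero_and_padicValInt_eq_of_twist_pStar p hp2 W V hW6 C hC
  have hN : V.conductorNorm ℤ = W.conductorNorm ℤ := conductorNorm_eq_of_twist_pStar p hp5 W V hadd hV C hC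
  -- `E[p]` irreducible for `V`
  have hd0 : ((-1 : ℚ) ^ (p / 2) * p) ≠ 0 :=
    mul_ne_zero (pow_ne_zero _ (by norm_num)) (by exact_mod_cast hpP.ne_zero)
  have hC' : C⁻¹ • V = W.quadraticTwist ((-1 : ℚ) ^ (p / 2) * p) := by rw [← hC, inv_smul_smul]
  have hirrV : Irr V p :=
    BurungaleSkinnerTianWan2024.hasIrreducibleModPGaloisRep_of_smul_eq_quadraticTwist W V p hd0 hC' hirr
  -- the optimal curve `W₀` of the twisted class and its lattice-optimal datum; `p ∤ c(D₀)` by `hStar`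
  obtain ⟨W₀, hE₀, hM₀, hNz₀, D₀, hiso, hN₀, hopt₀⟩ := X12.exists_isIsogenous_optimal hnf V
  haveI := hE₀
  haveI := hM₀
  haveI := hNz₀
  have hc₀ : ¬ (p : ℤ) ∣ D₀.c := hStar V C hC W₀ D₀ hiso hopt₀
  -- a `p`-good conductor-level datum of `V`
  obtain ⟨Dt, hct⟩ :=
    ManinFrameTransport.exists_modularParametrizationData_not_dvd_of_partner V hpP hirrV hiso D₀ hc₀
  obtain ⟨D', hc'⟩ := exists_datum_not_dvd_of_level_eq (hN₀.trans hN) Dt hct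
  -- K₅ at `(W, p, D, χ_{p*})` from the five named inputs, and the loss-free star involution
  have hsat := twistedPeriodLatticeSaturation_five_of_named_inputs hnf hT hWt hKr hEd W p D hpN hp5 hadd hirr hG hV4 hopt
    ((quadraticChar (ZMod p)).ringHomComp (Int.castRingHom ℂ)) (isQuadratic_quadraticChar_ringHomComp p)
    (isPrimitive_quadraticChar_ringHomComp p hp2)
  have hle := padicValInt_c_add_le_of_twist_datum_of_saturation p hp2 W V hadd hV C hC D hopt hpN D' hsat
  rw [hu, padicValInt.eq_zero_of_not_dvd hc'] at hle
  have hc0 : D.c ≠ 0 := D.maninConstant_ne_zero_holds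
  intro hdvd
  have h1 : 1 ≤ padicValInt p D.c := by
    rw [← pow_one (p : ℤ), padicValInt_dvd_iff] at hdvd
    exact hdvd.resolve_left hc0
  push_cast at hle
  omega

/-- **The Kummer corner from the five prints and the starred partner's Manin unit** (CORNER `KummerCornerTorsionOptimalManinUnit`,
stmt-BirchSwinnertonDyer-23883, on its own binders; WILD 24306 / TAME 24307 are its halves).  For `W` globally minimal with
`(p, ord_pΔ_min) ∈ {(5, 3), (7, 2)}`, additive, `E[p]` irreducible, (G)-ordinary, with a `ℚ_p`-rational point of order `p` (unused) and a
lattice-optimal conductor-level datum `D`: GRANTED the five named inputs of K AND `hStar` (every `X₀`-optimal curve in the class of a minimal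
model of `W ⊗ χ_{p*}` — Kodaira III* at 5, resp. IV* at 7 — has `p ∤ c`), `p ∤ c(D)`.  This is the F″-free transferred prefix of the GE11
argument with its single non-transferring step as an explicit hypothesis; CORNER is NOT proved by this; BSD is not proved by this.
[cite: EdixhovenManin1991, §4 and Thm. 3] [cite: Kraus1997Dissertationes, Prop. 1] [cite: Edixhoven1992, Thm. 4.5] -/
theorem kummerCorner_of_named_inputs_of_starredClass (hnf : exists_isNewformOf)
    (hT : fullLevelHomology_isIsotypic_tamePrincipalSeries_of_central)
    (hWt : fullLevelHomology_twist_isModular_of_eigenMap_signed)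
    (hKr : Kraus1997.propOne_inertiaShape_of_ordinary) (hEd : edixhoven1992_serreWeight_le_weight_of_newform)
    (W : WeierstrassCurve ℚ) [W.IsElliptic] [W.IsGloballyMinimal] (p : ℕ) [Fact p.Prime] [NeZero (W.conductorNorm ℤ)]
    (D : ModularParametrizationData W (W.conductorNorm ℤ))
    (hcell : (p = 5 ∧ padicValInt p W.minimalDiscriminantInt = 3) ∨ (p = 7 ∧ padicValInt p W.minimalDiscriminantInt = 2))
    (hadd : Addv W p) (hirr : Irr W p) (hG : TypeGOrd W p)
    (_htor : ∃ P : (W.baseChange ℚ_[p]).toAffine.Point, p • P = 0 ∧ P ≠ 0)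
    (hStar : ∀ (V : WeierstrassCurve ℚ) [V.IsElliptic] [V.IsGloballyMinimal] (C : VariableChange ℚ),
      C • W.quadraticTwist ((-1 : ℚ) ^ (p / 2) * p) = V →
      ∀ (W₀ : WeierstrassCurve ℚ) [W₀.IsElliptic] [W₀.IsGloballyMinimal] [NeZero (W₀.conductorNorm ℤ)]
        (D₀ : ModularParametrizationData W₀ (W₀.conductorNorm ℤ)),
        IsIsogenous V W₀ → (∀ z ∈ D₀.L.lattice, ∃ w ∈ periodLattice D₀.f, z = D₀.c * w) → ¬ (p : ℤ) ∣ D₀.c)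
    (hopt : ∀ z ∈ D.L.lattice, ∃ w ∈ periodLattice D.f, z = D.c * w) :
    ¬ (p : ℤ) ∣ D.c := by
  have hp5 : 5 ≤ p := by rcases hcell with ⟨rfl, -⟩ | ⟨rfl, -⟩ <;> norm_num
  have hV4 : padicValInt p W.minimalDiscriminantInt ≤ 4 := by rcases hcell with ⟨-, h⟩ | ⟨-, h⟩ <;> omega
  exact not_dvd_c_of_named_inputs_of_starredClass hnf hT hWt hKr hEd W p D hp5 hadd hirr hG hV4 hopt hStar

/-! ### Appended (same seat, g29): `hStar` at `7 < p` IS Edixhoven's Kodaira-type theorem — the obstruction is exactly his range -/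

/-- **The starred-class Manin unit `hStar` at `7 < p` from Edixhoven 1991 Thm. 3** (Kodaira-type half, the cite-only named fact
`edixhoven_not_dvd_maninConstant_of_kodairaSymbol_ne`) and Dokchitser–Dokchitser (a tree theorem): for `W` minimal, additive, (G)-ordinary,
`ord_pΔ_min ≤ 4`, `E[p]` irreducible at `p > 7`, every `X₀`-optimal `W₀` isogenous to a minimal model `V` of `W ⊗ χ_{p*}` has `p ∤ c(D₀)`:
`V` is additive with `0 ≤ ord_p j`, the prime-to-`p` cyclic isogeny (`E[p]` irreducible) preserves `ord_pΔ_min > 4`, so `W₀` is of starred type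
and Edixhoven applies.  This is the step of the GE11 glue `ordinaryLowValuationOfSaturation_proof`, isolated; at `p ∈ {5, 7}` it has no printed
counterpart (module docstring). [cite: EdixhovenManin1991, Thm. 3] [cite: DokchitserDokchitser2015LocalInvariants, Thm. 5.1 (1)] -/
theorem starredClass_not_dvd_c_of_edixhovenKodaira (hEdxK : edixhoven_not_dvd_maninConstant_of_kodairaSymbol_ne)
    (W : WeierstrassCurve ℚ) [W.IsElliptic] [W.IsGloballyMinimal] (p : ℕ) [Fact p.Prime] (hp7 : 7 < p)
    (hirr : Irr W p) (hG : TypeGOrd W p) (hV4 : padicValInt p W.minimalDiscriminantInt ≤ 4) :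
    ∀ (V : WeierstrassCurve ℚ) [V.IsElliptic] [V.IsGloballyMinimal] (C : VariableChange ℚ),
      C • W.quadraticTwist ((-1 : ℚ) ^ (p / 2) * p) = V →
      ∀ (W₀ : WeierstrassCurve ℚ) [W₀.IsElliptic] [W₀.IsGloballyMinimal] [NeZero (W₀.conductorNorm ℤ)]
        (D₀ : ModularParametrizationData W₀ (W₀.conductorNorm ℤ)),
        IsIsogenous V W₀ → (∀ z ∈ D₀.L.lattice, ∃ w ∈ periodLattice D₀.f, z = D₀.c * w) → ¬ (p : ℤ) ∣ D₀.c := by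
  intro V _ _ C hC W₀ _ _ _ D₀ hiso hopt₀
  have hpP : p.Prime := Fact.out
  have hp2 : p ≠ 2 := by omega
  have hj : 0 ≤ padicValRat p W.j := padicValRat_j_nonneg_of_typeGOrd W p hG
  have hW6 : padicValInt p W.minimalDiscriminantInt < 6 := by omega
  obtain ⟨hV, hjV, h6⟩ := addv_of_twist_pStar p hp2 W V hj hW6 C hC
  -- `E[p]` irreducible for `V`
  have hd0 : ((-1 : ℚ) ^ (p / 2) * p) ≠ 0 :=
    mul_ne_zero (pow_ne_zero _ (by norm_num)) (by exact_mod_cast hpP.ne_zero)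
  have hC' : C⁻¹ • V = W.quadraticTwist ((-1 : ℚ) ^ (p / 2) * p) := by rw [← hC, inv_smul_smul]
  have hirrV : Irr V p :=
    BurungaleSkinnerTianWan2024.hasIrreducibleModPGaloisRep_of_smul_eq_quadraticTwist W V p hd0 hC' hirr
  have hadd₀ : Addv W₀ p := (X2.addv_iff_of_isIsogenous (p := p) hiso).mp hV
  have h4₀ : 4 < padicValInt p W₀.minimalDiscriminantInt := by
    -- Dokchitser–Dokchitser (tree theorem) along a cyclic isogeny of degree prime to `p` (`Irr`)
    obtain ⟨ψ, hψ⟩ := hiso.exists_isCyclic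
    have hdeg : ¬ p ∣ ψ.degree := X11b.not_dvd_degree_of_isCyclic_of_irr ψ hψ hpP hirrV
    rw [← dokchitser_padicValInt_minimalDiscriminantInt_eq_of_isogeny_of_not_dvd_degree_holds V W₀ ψ
      p hpP hdeg hjV]
    omega
  exact Addv.not_dvd_maninConstant_of_four_lt W₀ p hEdxK D₀ hopt₀ (by omega) hadd₀ h4₀

/-- **Consistency with GE11**: at `7 < p` (i.e. `p ≥ 11`) the starred-class hypothesis is discharged by Edixhoven's theorem, and
`not_dvd_c_of_named_inputs_of_starredClass` gives back the GE11 conclusion `p ∤ c(D)` from SIX named inputs (pointwise form of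
`KOfNamedInputs.ordinaryLowValuationOptimalManinUnitGeEleven_of_named_inputs`, now through K₅).  So the Kummer-corner obstruction is EXACTLY the
range `7 < p` of `edixhoven_not_dvd_maninConstant_of_kodairaSymbol_ne`.  BSD is not proved by this. [cite: EdixhovenManin1991, Thm. 3 and §4] -/
theorem not_dvd_c_of_six_named_inputs (hnf : exists_isNewformOf)
    (hEdxK : edixhoven_not_dvd_maninConstant_of_kodairaSymbol_ne)
    (hT : fullLevelHomology_isIsotypic_tamePrincipalSeries_of_central)
    (hWt : fullLevelHomology_twist_isModular_of_eigenMap_signed)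
    (hKr : Kraus1997.propOne_inertiaShape_of_ordinary) (hEd : edixhoven1992_serreWeight_le_weight_of_newform)
    (W : WeierstrassCurve ℚ) [W.IsElliptic] [W.IsGloballyMinimal] (p : ℕ) [Fact p.Prime] [NeZero (W.conductorNorm ℤ)]
    (D : ModularParametrizationData W (W.conductorNorm ℤ)) (hp7 : 7 < p)
    (hadd : Addv W p) (hirr : Irr W p) (hG : TypeGOrd W p) (hV4 : padicValInt p W.minimalDiscriminantInt ≤ 4)
    (hopt : ∀ z ∈ D.L.lattice, ∃ w ∈ periodLattice D.f, z = D.c * w) :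
    ¬ (p : ℤ) ∣ D.c :=
  not_dvd_c_of_named_inputs_of_starredClass hnf hT hWt hKr hEd W p D (by omega) hadd hirr hG hV4 hopt
    (starredClass_not_dvd_c_of_edixhovenKodaira hEdxK W p hp7 hirr hG hV4)

end KFive

end Summit.BirchSwinnertonDyer.BirchSwinnertonDyer.Theorems.TeichmullerTwistDescent
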